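import Mathlib.Analysis.SpecialFunctions.Complex.Log
import Mathlib.Analysis.SpecialFunctions.Complex.LogBounds
import Mathlib.Analysis.SpecialFunctions.Log.Deriv
import Mathlib.Analysis.SpecialFunctions.Trigonometric.DerivHyp
import Mathlib.Analysis.SpecialFunctions.Pow.Real
import Mathlib.Analysis.SpecialFunctions.Integrals.Basic
import Mathlib.Analysis.SpecificLimits.Normed
import Mathlib.MeasureTheory.Integral.IntervalIntegral.Basic
import Mathlib.MeasureTheory.Integral.DominatedConvergence
import Literature.Analysis.Toeplitz.StrongSzego
import Literature.Probability.LatticeModels.OnsagerYangProofs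
import Literature.Probability.LatticeModels.IsingTorusTransfer
import HarnessLib

/-!
# The Onsager–Yang magnetisation: the exact solution in Toeplitz form

Topic `Probability/LatticeModels`, namespace `Literature.Probability.LatticeModels`. Third file of
the Benettin–Gallavotti–Jona-Lasinio–Stella route to the named fact
`Literature.Probability.LatticeModels.onsager_yang` (**crit-ising.S16**; `OnsagerYang.lean`,
`OnsagerYangProofs.lean`). After `OnsagerYangProofs.onsager_yang_of_exactSolution` the formula
rests on three statements about the iterated torus limit `(σ_{(0,0)}σ_{(k,0)})_p(β)` of the row
two-point function — existence (BGJS (3.3)), the Montroll–Potts–Ward long-range order (3.4), and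
Lebowitz's decay (eq. (3.3) of CMP 28) —, i.e. on the exact solution. This file opens the exact
solution one layer, along

* P. Deift, A. Its, I. Krasovsky, *Toeplitz matrices and Toeplitz determinants under the impetus
  of the Ising model*, Comm. Pure Appl. Math. **66** (2013) 1360–1438 ("DIK"), §2 (eqs. (21)–(26):
  Onsager's symbol `φ_Onsager`, `γ₁ = z₁z₂*`, `γ₂ = z₂*/z₁`, `T ≷ T_c ⟺ γ₂ ≷ 1`), §4 (eq. (50):
  `⟨σ_{1,1}σ_{1,1+n}⟩ = D_n(φ_Onsager)`, Potts–Ward 1955 / Montroll–Potts–Ward 1963; eq. (51): the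
  Fourier coefficients of `log φ_Onsager`; the strong Szegő limit theorem then gives
  `M_0² = (1 − k²)^{1/4}`) and §5 (eq. (64): Wu's 1966 asymptotics for `T > T_c`),

and reduces `onsager_yang` to THREE named facts of two kinds (`onsager_yang_of_toeplitz`):

* the exact-solution identity `torusRowPair_tendsto_toeplitzDet` (MPW 1963 / SML 1964: the
  in-row correlations of the cylinder state converge, as the width `N → ∞`, to the Toeplitz
  determinant `D_k(φ_β)` of Onsager's symbol) — the part that needs the diagonalisation of the
  transfer matrix (Kaufman 1949; Schultz–Mattis–Lieb 1964);
* two statements of pure analysis about explicit objects: the strong Szegő limit theorem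
  (`Literature.Analysis.Toeplitz.strongSzego`, DIK Thm. 7) and Wu's exponential decay of
  `D_k(φ_β)` for `β < β_c(2)` (`toeplitzDet_onsagerSymbol_exp_decay`, DIK eq. (64)).

The third printed ingredient, the Fourier coefficients of `log φ_β` (DIK eq. (51)), is stated as
`onsagerLog_circleCoeff` and PROVED (`onsagerLog_circleCoeff_holds`).

## Contents

* `onsagerGammaOne β = tanh β · e^{-2β}`, `onsagerGammaTwo β = e^{-2β}/tanh β` (DIK (22) with
  `J₁ = J₂ = 1`, `z* = (1−z)/(1+z) = e^{-2β}`: `one_sub_tanh_div_one_add_tanh`), with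
  `0 < γ₁ < γ₂`, `γ₁ < 1`, `γ₁γ₂ = e^{-4β}`, and **`γ₂ < 1 ⟺ β > β_c(2)`**, `γ₂ > 1 ⟺ β < β_c(2)`,
  `γ₂ = 1 ⟺ β = β_c(2)` (DIK (26); through `tanh β − e^{-2β} = e^{-β}(sinh 2β − 1)/cosh β` and
  `sinh 2β_c(2) = 1`);
* `onsagerSymbol β θ = w/|w|`, `w = (1 − γ₁e^{iθ})(1 − γ₂e^{-iθ})` (DIK (24)), of modulus one and
  `2π`-periodic; for `β > β_c(2)` its continuous logarithm `onsagerLog β θ = i(arg(1−γ₁e^{iθ}) +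
  arg(1−γ₂e^{-iθ}))` with `exp_onsagerLog : exp V_β = φ_β`, `continuous_onsagerLog`,
  `onsagerLog_periodic`;
* the named facts `torusRowPair_tendsto_toeplitzDet`, `onsagerLog_circleCoeff` (discharged below),
  `toeplitzDet_onsagerSymbol_exp_decay`;
* proved: the "elementary algebra" `(1−γ₁²)(1−γ₂²)/(1−γ₁γ₂)² = 1 − sinh(2β)^{-4}`
  (`onsagerGamma_szego_identity`), the Szegő sum `∑ ℓ V_ℓ V_{−ℓ} = ¼ log[…]`
  (`hasSum_szego_onsagerLog`) and `exp` of it `= m_O(β)²` (`exp_szego_onsager_eq_sq`), the Szegő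
  hypothesis `∑ |k| |V_k|² < ∞` for `V_β`, hence `D_n(φ_β) → m_O(β)²` (`tendsto_toeplitzDet_onsagerSymbol`);
  **DIK eq. (51)** (`onsagerLog_circleCoeff_holds`: the logarithmic series
  `V_β(θ) = ∑ c_n (e^{inθ} − e^{−inθ})`, `c_n = (γ₂ⁿ − γ₁ⁿ)/(2n)` (`hasSum_onsagerLog`), termwise
  integration by dominated convergence and the orthogonality `∫_{-π}^{π} e^{imθ} dθ = 2π δ_{m0}`);
  the reductions of the three facts of `OnsagerYangProofs.onsager_yang_of_exactSolution` at
  `β ∉ {0, β_c(2)}` (`tendsto_torusRowPair_outer_of_toeplitz`, `torusRowPairLimit_eq_toeplitzDet`,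
  `torusRowPairLimit_sandwich_at`, `torusRowPairLimit_tendsto_onsagerYang_sq_of_toeplitz`,
  `torusRowPairLimit_exp_decay_of_toeplitz`), and the assemblies `onsager_yang_of_toeplitz`,
  `criticalBeta_two_of_toeplitz`.

## Faithfulness notes

* DIK's `T_n(φ) = (φ_{j−k})` and `φ_ℓ = ∫_{-π}^{π} e^{-iℓθ} φ dθ/2π` are `toeplitzMatrix`/`circleCoeff`
  of `Literature.Analysis.Toeplitz` verbatim (`circleCoeff = fourierCoeffOn (-π < π)`);
  `D_n(φ(e^{-iθ})) = D_n(φ)` (transpose), so the orientation of the row is immaterial. The identity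
  (50) is printed for the infinite-volume correlation "along a row"; it is vendored for the tree's
  object, the iterated periodic limit of BGJS (3.3) (inner limit `M → ∞` by the transfer matrix, a
  theorem of `IsingTorusTransfer`; outer limit `N → ∞` asserted to converge to `D_k(φ_β)`), which is
  how BGJS use "[3]" = MPW + SML, and DIK §1 recall that this two-point function is
  boundary-condition independent "(cf. [BGJ-LS])". `β = β_c(2)` (symbol (25), jump) and `β = 0` are
  excluded; they are not needed.
* Wu's theorem is recorded only as "`|D_k(φ_β)| ≤ C e^{-ck}`, some `C`, some `c > 0`", weaker than
  the printed asymptotics `(πk)^{-1/2} γ₂^{-k} (…)(1 + O(1/k))`.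
* Numerical sanity check (session notes): with these conventions `D_n(φ_β)` computed from 4096-point
  Fourier coefficients gives `0.947914` at `β = 0.6` for `n ≥ 10` against
  `(1 − sinh(1.2)^{-4})^{1/4} = 0.947914`, and decays like `e^{-0.42 k}` at `β = 0.35`.

## References

* E. W. Montroll, R. B. Potts, J. C. Ward, J. Math. Phys. 4 (1963) 308–322.
* T. D. Schultz, D. C. Mattis, E. H. Lieb, Rev. Mod. Phys. 36 (1964) 856–871, §V.
* T. T. Wu, Phys. Rev. 149 (1966) 380–401.
* P. Deift, A. Its, I. Krasovsky, Comm. Pure Appl. Math. 66 (2013) 1360–1438, §§2, 4, 5.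
* G. Benettin, G. Gallavotti, G. Jona-Lasinio, A. L. Stella, Comm. Math. Phys. 30 (1973) 45–54.
* J. L. Lebowitz, Comm. Math. Phys. 28 (1972) 313–321, §III.
-/

noncomputable section

open Filter Topology Complex

namespace Literature.Probability.LatticeModels

/-! ### Onsager's parameters `γ₁`, `γ₂` in the isotropic case -/

/-- `γ₁ = z z*` with `z = tanh β`, `z* = (1 − z)/(1 + z) = e^{-2β}` (DIK eq. (22), `J₁ = J₂ = 1`). [cite: DeiftItsKrasovsky2013, §2, eq. (22)] -/
def onsagerGammaOne (β : ℝ) : ℝ := Real.tanh β * Real.exp (-2 * β)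

/-- `γ₂ = z*/z = e^{-2β} / tanh β` (DIK eq. (22), `J₁ = J₂ = 1`). [cite: DeiftItsKrasovsky2013, §2, eq. (22)] -/
def onsagerGammaTwo (β : ℝ) : ℝ := Real.exp (-2 * β) / Real.tanh β

/-- `z* = (1 − z)/(1 + z) = e^{-2β}` for `z = tanh β` (DIK eq. (22) with `J₂ = 1`). [folklore] -/
theorem one_sub_tanh_div_one_add_tanh (β : ℝ) :
    (1 - Real.tanh β) / (1 + Real.tanh β) = Real.exp (-2 * β) := by
  rw [Real.tanh_eq_sinh_div_cosh]
  have hc : 0 < Real.cosh β := Real.cosh_pos β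
  have h1 : Real.exp (-β) = Real.cosh β - Real.sinh β := (Real.cosh_sub_sinh β).symm
  have h2 : Real.exp (-2 * β) = (Real.cosh β - Real.sinh β) ^ 2 := by
    rw [show (-2 : ℝ) * β = -β + -β by ring, Real.exp_add, h1]; ring
  have h3 : Real.cosh β + Real.sinh β ≠ 0 := by
    have := Real.cosh_add_sinh β; rw [this]; exact (Real.exp_pos β).ne'
  have h4 := Real.cosh_sq_sub_sinh_sq β
  rw [h2]
  field_simp
  linear_combination (-1 : ℝ) * h4

/-- `0 < γ₁` for `β > 0`. [cite: DeiftItsKrasovsky2013, §2, eq. (23)] -/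
theorem onsagerGammaOne_pos {β : ℝ} (hβ : 0 < β) : 0 < onsagerGammaOne β :=
  mul_pos (tanh_pos_of_pos hβ) (Real.exp_pos _)

/-- `γ₁ < 1` for `β > 0` (DIK eq. (23): `0 < γ₁ < 1`). [cite: DeiftItsKrasovsky2013, §2, eq. (23)] -/
theorem onsagerGammaOne_lt_one {β : ℝ} (hβ : 0 < β) : onsagerGammaOne β < 1 := by
  have h1 : Real.tanh β < 1 := Real.tanh_lt_one β
  have h2 : Real.exp (-2 * β) < 1 := Real.exp_lt_one_iff.mpr (by linarith)
  calc onsagerGammaOne β = Real.tanh β * Real.exp (-2 * β) := rfl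
    _ < 1 * 1 := mul_lt_mul'' h1 h2 (tanh_pos_of_pos hβ).le (Real.exp_pos _).le
    _ = 1 := one_mul 1

/-- `0 < γ₂` for `β > 0`. [cite: DeiftItsKrasovsky2013, §2, eq. (22)] -/
theorem onsagerGammaTwo_pos {β : ℝ} (hβ : 0 < β) : 0 < onsagerGammaTwo β :=
  div_pos (Real.exp_pos _) (tanh_pos_of_pos hβ)

/-- `γ₁ γ₂ = e^{-4β}`. [folklore] -/
theorem onsagerGammaOne_mul_onsagerGammaTwo {β : ℝ} (hβ : 0 < β) :
    onsagerGammaOne β * onsagerGammaTwo β = Real.exp (-4 * β) := by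
  have ht : Real.tanh β ≠ 0 := (tanh_pos_of_pos hβ).ne'
  rw [onsagerGammaOne, onsagerGammaTwo, show (-4 : ℝ) * β = -2 * β + -2 * β by ring, Real.exp_add]
  field_simp

/-- The key identity behind `T ≷ T_c ⟺ γ₂ ≷ 1` in the isotropic case:
`tanh β − e^{-2β} = e^{-β} (sinh 2β − 1) / cosh β`. [folklore] -/
theorem tanh_sub_exp_neg_two_mul (β : ℝ) :
    Real.tanh β - Real.exp (-2 * β) = Real.exp (-β) * (Real.sinh (2 * β) - 1) / Real.cosh β := by
  rw [Real.tanh_eq_sinh_div_cosh]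
  have hc : 0 < Real.cosh β := Real.cosh_pos β
  have h1 : Real.exp (-β) = Real.cosh β - Real.sinh β := (Real.cosh_sub_sinh β).symm
  have h2 : Real.exp (-2 * β) = (Real.cosh β - Real.sinh β) ^ 2 := by
    rw [show (-2 : ℝ) * β = -β + -β by ring, Real.exp_add, h1]; ring
  have h3 := Real.sinh_two_mul β
  have h4 := Real.cosh_sq_sub_sinh_sq β
  rw [h2, h1, h3]
  field_simp
  linear_combination (-Real.cosh β) * h4

/-- **`γ₂ < 1 ⟺ β > β_c(2)`** (DIK eq. (26): `γ₂ ≷ 1 ⟺ k ≷ 1`, "sub-critical temperatures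
`T < T_c` correspond to `z₂* < z₁`"; here through `sinh 2β > 1 = sinh 2β_c(2)`). [cite: DeiftItsKrasovsky2013, §2, eq. (26)] -/
theorem onsagerGammaTwo_lt_one_iff {β : ℝ} (hβ : 0 < β) :
    onsagerGammaTwo β < 1 ↔ criticalBetaTwo < β := by
  rw [onsagerGammaTwo, div_lt_one (tanh_pos_of_pos hβ), ← sub_pos, tanh_sub_exp_neg_two_mul]
  have hpos : 0 < Real.exp (-β) / Real.cosh β := div_pos (Real.exp_pos _) (Real.cosh_pos β)
  rw [show Real.exp (-β) * (Real.sinh (2 * β) - 1) / Real.cosh β =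
      Real.exp (-β) / Real.cosh β * (Real.sinh (2 * β) - 1) by ring,
    mul_pos_iff_of_pos_left hpos, sub_pos, ← sinh_two_mul_criticalBetaTwo,
    Real.sinh_strictMono.lt_iff_lt]
  constructor <;> intro h <;> linarith

/-- **`1 < γ₂ ⟺ β < β_c(2)`** (DIK eq. (26), the super-critical case `T > T_c`). [cite: DeiftItsKrasovsky2013, §2, eq. (26)] -/
theorem one_lt_onsagerGammaTwo_iff {β : ℝ} (hβ : 0 < β) :
    1 < onsagerGammaTwo β ↔ β < criticalBetaTwo := by
  rw [onsagerGammaTwo, one_lt_div (tanh_pos_of_pos hβ), ← sub_neg, tanh_sub_exp_neg_two_mul]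
  have hpos : 0 < Real.exp (-β) / Real.cosh β := div_pos (Real.exp_pos _) (Real.cosh_pos β)
  rw [show Real.exp (-β) * (Real.sinh (2 * β) - 1) / Real.cosh β =
      Real.exp (-β) / Real.cosh β * (Real.sinh (2 * β) - 1) by ring,
    mul_neg_iff, sub_neg, sub_pos, ← sinh_two_mul_criticalBetaTwo, Real.sinh_strictMono.lt_iff_lt,
    Real.sinh_strictMono.lt_iff_lt]
  constructor
  · rintro (⟨-, h⟩ | ⟨h, -⟩)
    · linarith
    · exact absurd hpos (not_lt.2 h.le)
  · intro h; exact Or.inl ⟨hpos, by linarith⟩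

/-- `γ₂ = 1 ⟺ β = β_c(2)` (DIK: "`T = T_c ⟺ z₂* = z₁`"). [cite: DeiftItsKrasovsky2013, §2, eq. (26)] -/
theorem onsagerGammaTwo_eq_one_iff {β : ℝ} (hβ : 0 < β) :
    onsagerGammaTwo β = 1 ↔ β = criticalBetaTwo := by
  constructor
  · intro h
    rcases lt_trichotomy β criticalBetaTwo with hlt | heq | hgt
    · exact absurd h (ne_of_gt ((one_lt_onsagerGammaTwo_iff hβ).2 hlt))
    · exact heq
    · exact absurd h (ne_of_lt ((onsagerGammaTwo_lt_one_iff hβ).2 hgt))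
  · rintro rfl
    have h1 := (onsagerGammaTwo_lt_one_iff criticalBetaTwo_pos).not.2 (lt_irrefl _)
    have h2 := (one_lt_onsagerGammaTwo_iff criticalBetaTwo_pos).not.2 (lt_irrefl _)
    push Not at h1 h2
    exact le_antisymm h2 h1

/-- `γ₁ < γ₂` for `β > 0` (DIK eq. (23)): `γ₁/γ₂ = tanh² β < 1`. [cite: DeiftItsKrasovsky2013, §2, eq. (23)] -/
theorem onsagerGammaOne_lt_onsagerGammaTwo {β : ℝ} (hβ : 0 < β) :
    onsagerGammaOne β < onsagerGammaTwo β := by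
  have ht := tanh_pos_of_pos hβ
  have ht1 : Real.tanh β < 1 := Real.tanh_lt_one β
  rw [onsagerGammaOne, onsagerGammaTwo, lt_div_iff₀ ht]
  have he : 0 < Real.exp (-2 * β) := Real.exp_pos _
  have : Real.tanh β * Real.tanh β < 1 := by nlinarith
  nlinarith

/-! ### Onsager's symbol (DIK eq. (24)) -/

/-- The unnormalised product `w_β(θ) = (1 − γ₁ e^{iθ})(1 − γ₂ e^{-iθ})` whose phase is Onsager's
symbol (DIK eq. (24)). [cite: DeiftItsKrasovsky2013, §2, eq. (24)] -/
def onsagerW (β θ : ℝ) : ℂ :=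
  (1 - onsagerGammaOne β * Complex.exp (θ * I)) * (1 - onsagerGammaTwo β * Complex.exp (-(θ * I)))

/-- **Onsager's symbol** in the isotropic case `J₁ = J₂ = 1` (Onsager 1944; Kaufman–Onsager 1949;
Montroll–Potts–Ward 1963; Deift–Its–Krasovsky 2013, eq. (21) with the branch `φ(e^{iπ}) > 0`,
equivalently, for `γ₂ ≠ 1`, i.e. `β ≠ β_c(2)`, eq. (24)):
`φ_β(e^{iθ}) = (1 − γ₁ e^{iθ})(1 − γ₂ e^{-iθ}) / |(1 − γ₁ e^{iθ})(1 − γ₂ e^{-iθ})|`, a continuous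
function of modulus one on the circle, of winding number `0` for `β > β_c(2)` (`γ₂ < 1`) and `−1` for
`β < β_c(2)` (`γ₂ > 1`). (At `β = β_c(2)` the printed symbol is eq. (25), with a jump at `θ = 0`; the
present expression is then the junk value `0` at `θ = 0`.) [cite: DeiftItsKrasovsky2013, §2, eq. (24)] -/
def onsagerSymbol (β θ : ℝ) : ℂ :=
  onsagerW β θ / (‖onsagerW β θ‖ : ℂ)

/-- `‖γ e^{±iθ}‖ = γ` for `γ ≥ 0`. [folklore] -/
theorem norm_real_mul_exp_mul_I {γ : ℝ} (hγ : 0 ≤ γ) (x : ℝ) :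
    ‖(γ : ℂ) * Complex.exp (x * I)‖ = γ := by
  rw [norm_mul, Complex.norm_real, Real.norm_of_nonneg hγ, Complex.norm_exp_ofReal_mul_I, mul_one]

/-- The first factor `1 − γ₁ e^{iθ}` has positive real part (`γ₁ < 1`). [folklore] -/
theorem re_one_sub_gammaOne_pos {β : ℝ} (hβ : 0 < β) (θ : ℝ) :
    0 < (1 - (onsagerGammaOne β : ℂ) * Complex.exp (θ * I)).re := by
  have h1 : ((onsagerGammaOne β : ℂ) * Complex.exp (θ * I)).re ≤ onsagerGammaOne β := by
    refine (Complex.re_le_norm _).trans ?_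
    rw [norm_real_mul_exp_mul_I (onsagerGammaOne_pos hβ).le]
  have h2 := onsagerGammaOne_lt_one hβ
  simp only [Complex.sub_re, Complex.one_re]
  linarith

/-- Above `β_c(2)` the second factor `1 − γ₂ e^{-iθ}` has positive real part (`γ₂ < 1`). [folklore] -/
theorem re_one_sub_gammaTwo_pos {β : ℝ} (hβ : criticalBetaTwo < β) (θ : ℝ) :
    0 < (1 - (onsagerGammaTwo β : ℂ) * Complex.exp (-(θ * I))).re := by
  have hβ0 : 0 < β := criticalBetaTwo_pos.trans hβ
  have h1 : ((onsagerGammaTwo β : ℂ) * Complex.exp (-(θ * I))).re ≤ onsagerGammaTwo β := by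
    refine (Complex.re_le_norm _).trans ?_
    rw [show -((θ : ℂ) * I) = ((-θ : ℝ) : ℂ) * I by push_cast; ring,
      norm_real_mul_exp_mul_I (onsagerGammaTwo_pos hβ0).le]
  have h2 := (onsagerGammaTwo_lt_one_iff hβ0).2 hβ
  simp only [Complex.sub_re, Complex.one_re]
  linarith

/-- The first factor never vanishes (`β > 0`). [folklore] -/
theorem one_sub_gammaOne_ne_zero {β : ℝ} (hβ : 0 < β) (θ : ℝ) :
    (1 - (onsagerGammaOne β : ℂ) * Complex.exp (θ * I)) ≠ 0 := fun h => by
  have := re_one_sub_gammaOne_pos hβ θ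
  rw [h, Complex.zero_re] at this
  exact lt_irrefl 0 this

/-- The second factor never vanishes off the critical point (`γ₂ ≠ 1`):
`‖1 − γ₂ e^{-iθ}‖ ≥ |1 − γ₂| > 0`. [folklore] -/
theorem one_sub_gammaTwo_ne_zero {β : ℝ} (hβ : 0 < β) (hβc : β ≠ criticalBetaTwo) (θ : ℝ) :
    (1 - (onsagerGammaTwo β : ℂ) * Complex.exp (-(θ * I))) ≠ 0 := by
  intro h
  have hn : ‖(1 : ℂ)‖ = ‖(onsagerGammaTwo β : ℂ) * Complex.exp (-(θ * I))‖ := by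
    rw [sub_eq_zero.1 h]
  rw [norm_one, show -((θ : ℂ) * I) = ((-θ : ℝ) : ℂ) * I by push_cast; ring,
    norm_real_mul_exp_mul_I (onsagerGammaTwo_pos hβ).le] at hn
  exact hβc ((onsagerGammaTwo_eq_one_iff hβ).1 hn.symm)

/-- `w_β(θ) ≠ 0` for `β > 0`, `β ≠ β_c(2)`. [cite: DeiftItsKrasovsky2013, §2, eq. (24)] -/
theorem onsagerW_ne_zero {β : ℝ} (hβ : 0 < β) (hβc : β ≠ criticalBetaTwo) (θ : ℝ) :
    onsagerW β θ ≠ 0 :=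
  mul_ne_zero (one_sub_gammaOne_ne_zero hβ θ) (one_sub_gammaTwo_ne_zero hβ hβc θ)

/-- Onsager's symbol has modulus one (off the critical point). [cite: DeiftItsKrasovsky2013, §2, eq. (24)] -/
theorem norm_onsagerSymbol {β : ℝ} (hβ : 0 < β) (hβc : β ≠ criticalBetaTwo) (θ : ℝ) :
    ‖onsagerSymbol β θ‖ = 1 := by
  have h := onsagerW_ne_zero hβ hβc θ
  rw [onsagerSymbol, norm_div, Complex.norm_real, Real.norm_of_nonneg (norm_nonneg _),
    div_self (norm_ne_zero_iff.2 h)]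

/-- Onsager's symbol is `2π`-periodic in the angle. [folklore] -/
theorem onsagerSymbol_periodic (β : ℝ) : Function.Periodic (onsagerSymbol β) (2 * Real.pi) := by
  intro θ
  have h : Complex.exp (((θ + 2 * Real.pi : ℝ) : ℂ) * I) = Complex.exp (θ * I) := by
    rw [show ((θ + 2 * Real.pi : ℝ) : ℂ) * I = θ * I + 2 * Real.pi * I by push_cast; ring]
    exact Complex.exp_periodic _
  have h' : Complex.exp (-(((θ + 2 * Real.pi : ℝ) : ℂ) * I)) = Complex.exp (-(θ * I)) := by
    rw [Complex.exp_neg, Complex.exp_neg, h]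
  simp only [onsagerSymbol, onsagerW, h, h']

/-! ### The logarithm of the symbol above `β_c` (zero winding) -/

/-- For `β > β_c(2)` (`γ₁, γ₂ < 1`, no winding) the continuous logarithm of Onsager's symbol,
`V_β(θ) = log φ_β(e^{iθ}) = i (arg(1 − γ₁e^{iθ}) + arg(1 − γ₂e^{-iθ}))`
`= ½[Log(1 − γ₁e^{iθ}) + Log(1 − γ₂e^{-iθ}) − Log(1 − γ₁e^{-iθ}) − Log(1 − γ₂e^{iθ})]` (principal
branches; DIK §4, the computation leading to eq. (51): "`φ^{±1} ≠ 0` and `φ` has no winding on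
`S¹`"). [cite: DeiftItsKrasovsky2013, §4, eq. (51)] -/
def onsagerLog (β θ : ℝ) : ℂ :=
  (((Complex.log (1 - onsagerGammaOne β * Complex.exp (θ * I))).im +
      (Complex.log (1 - onsagerGammaTwo β * Complex.exp (-(θ * I)))).im : ℝ) : ℂ) * I

/-- `e^{i arg z} = z / ‖z‖` for `z ≠ 0`. [folklore] -/
theorem exp_arg_mul_I_eq_div {z : ℂ} (hz : z ≠ 0) :
    Complex.exp ((Complex.arg z : ℂ) * I) = z / (‖z‖ : ℂ) := by
  have h := Complex.norm_mul_exp_arg_mul_I z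
  have hn : (‖z‖ : ℂ) ≠ 0 := by exact_mod_cast norm_ne_zero_iff.2 hz
  rw [eq_div_iff hn, mul_comm, h]

/-- **`exp V_β = φ_β` above `β_c(2)`**: the symbol is the exponential of its continuous logarithm
(DIK §3, before Theorem 7: "if `φ` is non-zero, continuous and has zero winding number, then
`φ = e^V` for some continuous periodic `V = log φ`"). [cite: DeiftItsKrasovsky2013, §3, paragraph before Theorem 7] -/
theorem exp_onsagerLog {β : ℝ} (hβ : criticalBetaTwo < β) (θ : ℝ) :
    Complex.exp (onsagerLog β θ) = onsagerSymbol β θ := by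
  have hβ0 : 0 < β := criticalBetaTwo_pos.trans hβ
  set a : ℂ := 1 - onsagerGammaOne β * Complex.exp (θ * I) with ha
  set b : ℂ := 1 - onsagerGammaTwo β * Complex.exp (-(θ * I)) with hb
  have ha0 : a ≠ 0 := one_sub_gammaOne_ne_zero hβ0 θ
  have hb0 : b ≠ 0 := one_sub_gammaTwo_ne_zero hβ0 hβ.ne' θ
  have hsplit : onsagerLog β θ = (Complex.arg a : ℂ) * I + (Complex.arg b : ℂ) * I := by
    rw [onsagerLog, Complex.log_im, Complex.log_im]; push_cast; ring
  rw [hsplit, Complex.exp_add, exp_arg_mul_I_eq_div ha0, exp_arg_mul_I_eq_div hb0, onsagerSymbol,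
    show onsagerW β θ = a * b from rfl, norm_mul]
  have han : (‖a‖ : ℂ) ≠ 0 := by exact_mod_cast norm_ne_zero_iff.2 ha0
  have hbn : (‖b‖ : ℂ) ≠ 0 := by exact_mod_cast norm_ne_zero_iff.2 hb0
  push_cast
  field_simp

/-- `V_β` is continuous for `β > β_c(2)` (both factors stay in the right half plane, where the
principal logarithm is continuous). [folklore] -/
theorem continuous_onsagerLog {β : ℝ} (hβ : criticalBetaTwo < β) : Continuous (onsagerLog β) := by
  have hβ0 : 0 < β := criticalBetaTwo_pos.trans hβ
  have hc1 : Continuous fun θ : ℝ => (1 : ℂ) - onsagerGammaOne β * Complex.exp (θ * I) := by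
    fun_prop
  have hc2 : Continuous fun θ : ℝ => (1 : ℂ) - onsagerGammaTwo β * Complex.exp (-(θ * I)) := by
    fun_prop
  have hl1 : Continuous fun θ : ℝ => Complex.log (1 - onsagerGammaOne β * Complex.exp (θ * I)) :=
    hc1.clog fun θ => Complex.mem_slitPlane_iff.2 (Or.inl (re_one_sub_gammaOne_pos hβ0 θ))
  have hl2 : Continuous fun θ : ℝ =>
      Complex.log (1 - onsagerGammaTwo β * Complex.exp (-(θ * I))) :=
    hc2.clog fun θ => Complex.mem_slitPlane_iff.2 (Or.inl (re_one_sub_gammaTwo_pos hβ θ))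
  unfold onsagerLog
  refine Continuous.mul ?_ continuous_const
  exact Complex.continuous_ofReal.comp
    ((Complex.continuous_im.comp hl1).add (Complex.continuous_im.comp hl2))

/-- `V_β` is `2π`-periodic. [folklore] -/
theorem onsagerLog_periodic (β : ℝ) : Function.Periodic (onsagerLog β) (2 * Real.pi) := by
  intro θ
  have h : Complex.exp (((θ + 2 * Real.pi : ℝ) : ℂ) * I) = Complex.exp (θ * I) := by
    rw [show ((θ + 2 * Real.pi : ℝ) : ℂ) * I = θ * I + 2 * Real.pi * I by push_cast; ring]
    exact Complex.exp_periodic _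
  have h' : Complex.exp (-(((θ + 2 * Real.pi : ℝ) : ℂ) * I)) = Complex.exp (-(θ * I)) := by
    rw [Complex.exp_neg, Complex.exp_neg, h]
  simp only [onsagerLog, h, h']


/-! ### The exact solution as statements about Toeplitz determinants -/

section ExactSolution

open Literature.Analysis.Toeplitz

/-- **The row two-point function is a Toeplitz determinant of Onsager's symbol** (Potts–Ward 1955;
E. W. Montroll, R. B. Potts, J. C. Ward, J. Math. Phys. 4 (1963) 308, the formula recorded in
Deift–Its–Krasovsky, CPAM 66 (2013), §4, eq. (50): "`⟨σ_{1,1} σ_{1,1+n}⟩ = D_n(φ_Onsager)` where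
`φ_Onsager(e^{iθ})` is the Onsager function defined in (21)", with `D_n(φ) = det (φ_{j−k})_{0 ≤ j,k ≤ n−1}`,
`φ_ℓ = ∫_{-π}^{π} e^{-iℓθ} φ(e^{iθ}) dθ/2π` (ibid. eqs. (1)–(3)) and, for `γ₂ ≠ 1`, `φ_Onsager` given by
eq. (24); Schultz–Mattis–Lieb, Rev. Mod. Phys. 36 (1964) 856, §V (transfer matrix: the in-row
correlation of the cylinder state as a determinant, and its limit as the width `N → ∞`); this is
the exact-solution input "[3]" of Benettin–Gallavotti–Jona-Lasinio–Stella, CMP 30 (1973), §3 b),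
eqs. (3.3)–(3.4), for the iterated periodic limit `lim_N lim_M`). For the nearest-neighbour Ising
model on `ℤ²` (`J₁ = J₂ = 1`), `β > 0`, `β ≠ β_c(2)` and every `k`: the inner limits
`lim_M ⟨σ_{(0,0)}σ_{(k,0)}⟩_{p,NM}` (which exist by the transfer matrix,
`IsingTorusTransfer.tendsto_torusRowPair_inner`) converge, as `N → ∞`, to the Toeplitz determinant
`D_k(φ_β) = toeplitzDet (circleCoeff (onsagerSymbol β)) k` (a real number; `D_0 = 1 = ⟨σσ⟩` at
`k = 0`). This contains BGJS (3.3) (`tendsto_torusRowPair_outer_exists`) off `β ∈ {0, β_c(2)}` and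
identifies `torusRowPairLimit β k` with `D_k(φ_β)`. THE exact-solution input of the Onsager–Yang
formula that requires the diagonalisation of the transfer matrix (Kaufman 1949; SML 1964). [cite: MontrollPottsWard1963, main formula: row correlation = Toeplitz determinant of Onsager's function (= DeiftItsKrasovsky2013 §4 eq. (50))] [cite: DeiftItsKrasovsky2013, §4, eq. (50), with §1 eqs. (1)–(3) and §2 eqs. (21)–(24)] [cite: BenettinGallavottiJonaLasinioStella1973, §3 b), eqs. (3.3)–(3.4)] -/
def torusRowPair_tendsto_toeplitzDet : Prop :=
  ∀ ⦃β : ℝ⦄, 0 < β → β ≠ criticalBetaTwo → ∀ k : ℕ,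
    Tendsto (fun N : ℕ => ((limUnder atTop fun M : ℕ => torusRowPair β N M k : ℝ) : ℂ)) atTop
      (𝓝 (toeplitzDet (circleCoeff (onsagerSymbol β)) k))

/-- **The Fourier coefficients of `log φ_Onsager` below `T_c`** (Deift–Its–Krasovsky, CPAM 66
(2013), §4, eq. (51): for `T < T_c`, "`(log φ_Onsager)_ℓ = −(γ₁^ℓ/2ℓ − γ₂^ℓ/2ℓ)`, `ℓ ≥ 1`;
`(log φ_Onsager)_{−ℓ} = (γ₁^ℓ/2ℓ − γ₂^ℓ/2ℓ)`, `ℓ ≥ 1`, and `(log φ_Onsager)_0 = 0`" — the expansion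
`log(1 − γe^{±iθ}) = −∑ γ^n e^{±inθ}/n`, as in Montroll–Potts–Ward 1963). For `β > β_c(2)`, with
`V_β = onsagerLog β` the continuous logarithm of the symbol (`exp_onsagerLog`) and
`V_ℓ = circleCoeff V_β ℓ`. A calculus statement, kept as a named statement for reference and
PROVED below (`onsagerLog_circleCoeff_holds`). [cite: DeiftItsKrasovsky2013, §4, eq. (51)] -/
def onsagerLog_circleCoeff : Prop :=
  ∀ ⦃β : ℝ⦄, criticalBetaTwo < β →
    circleCoeff (onsagerLog β) 0 = 0 ∧
      ∀ ℓ : ℕ, 1 ≤ ℓ →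
        circleCoeff (onsagerLog β) ℓ =
            ((-((onsagerGammaOne β ^ ℓ - onsagerGammaTwo β ^ ℓ) / (2 * ℓ)) : ℝ) : ℂ) ∧
          circleCoeff (onsagerLog β) (-(ℓ : ℤ)) =
            (((onsagerGammaOne β ^ ℓ - onsagerGammaTwo β ^ ℓ) / (2 * ℓ) : ℝ) : ℂ)

/-- **Wu 1966: above `T_c` the Toeplitz determinants of Onsager's symbol decay exponentially**
(T. T. Wu, Phys. Rev. 149 (1966) 380, the `T > T_c` asymptotics recorded in Deift–Its–Krasovsky,
CPAM 66 (2013), §5, eq. (64): "For `T > T_c`, Wu showed that for `n → ∞`,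
`⟨σ_{1,1}σ_{1,1+n}⟩ = (πn)^{-1/2} γ₂^{-n} (1−γ₁²)^{1/4} (1−γ₂^{-2})^{-1/4} (1−γ₁γ₂)^{-1/2} (1 + A₁/n + …)`",
where `⟨σ_{1,1}σ_{1,1+n}⟩ = D_n(φ_Onsager)` by eq. (50) and `T > T_c ⟺ γ₂ > 1` by eq. (26); a
Toeplitz determinant with a symbol of winding number `−1`, ibid. §5). Recorded only through its
consequence, WEAKER than the printed asymptotics: for `0 < β < β_c(2)` there are `C` and `c > 0`
with `|D_k(φ_β)| ≤ C e^{-ck}` for all `k`. With `torusRowPair_tendsto_toeplitzDet` this yields the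
fact `torusRowPairLimit_exp_decay_of_lt_criticalBetaTwo` of `OnsagerYangProofs.lean` (Lebowitz
1972, eq. (3.3)). [cite: Wu1966, T > T_c asymptotics of D_n(φ_Onsager) (= DeiftItsKrasovsky2013 §5 eq. (64))] [cite: DeiftItsKrasovsky2013, §5, eq. (64) with eqs. (26), (50)] -/
def toeplitzDet_onsagerSymbol_exp_decay : Prop :=
  ∀ ⦃β : ℝ⦄, 0 < β → β < criticalBetaTwo →
    ∃ C c : ℝ, 0 < c ∧ ∀ k : ℕ,
      ‖toeplitzDet (circleCoeff (onsagerSymbol β)) k‖ ≤ C * Real.exp (-c * k)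

end ExactSolution

/-! ### The Szegő data of Onsager's symbol and the value `m_O(β)²` (DIK §4) -/

section SzegoData

open Literature.Analysis.Toeplitz

variable {β : ℝ}

/-- `sinh 2β = 2 tanh β / (1 − tanh² β)`. [folklore] -/
theorem sinh_two_mul_eq_tanh (β : ℝ) :
    Real.sinh (2 * β) = 2 * Real.tanh β / (1 - Real.tanh β ^ 2) := by
  have hc : Real.cosh β ≠ 0 := (Real.cosh_pos β).ne'
  rw [Real.sinh_two_mul, Real.tanh_eq_sinh_div_cosh, div_pow, one_sub_div (pow_ne_zero 2 hc),
    Real.cosh_sq_sub_sinh_sq]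
  field_simp

/-- **"Elementary algebra using (22)"** (Deift–Its–Krasovsky 2013, §4, after eq. (51)): in the
isotropic case, `(1 − γ₁²)(1 − γ₂²)/(1 − γ₁γ₂)² = 1 − sinh(2β)^{-4} = 1 − k²`, the base of the
Onsager–Yang formula (`m_O(β)² = (1 − k²)^{1/4}`, DIK eq. (15)). [cite: DeiftItsKrasovsky2013, §4, after eq. (51)] -/
theorem onsagerGamma_szego_identity (hβ : 0 < β) :
    (1 - onsagerGammaOne β ^ 2) * (1 - onsagerGammaTwo β ^ 2) /
        (1 - onsagerGammaOne β * onsagerGammaTwo β) ^ 2 =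
      1 - Real.sinh (2 * β) ^ (-(4 : ℤ)) := by
  have ht0 : 0 < Real.tanh β := tanh_pos_of_pos hβ
  have ht1 : Real.tanh β < 1 := Real.tanh_lt_one β
  have he : Real.exp (-2 * β) = (1 - Real.tanh β) / (1 + Real.tanh β) :=
    (one_sub_tanh_div_one_add_tanh β).symm
  have hs : Real.sinh (2 * β) = 2 * Real.tanh β / (1 - Real.tanh β ^ 2) := sinh_two_mul_eq_tanh β
  rw [onsagerGammaOne, onsagerGammaTwo, he, hs, zpow_neg, zpow_ofNat]
  generalize Real.tanh β = t at ht0 ht1 ⊢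
  have h1 : (1 : ℝ) + t ≠ 0 := by linarith
  have h2 : (1 : ℝ) - t ≠ 0 := by linarith
  have h3 : (1 : ℝ) - t ^ 2 ≠ 0 := by nlinarith
  have h4 : t ≠ 0 := ht0.ne'
  have h5' : 1 - t * ((1 - t) / (1 + t)) * ((1 - t) / (1 + t) / t) = 4 * t / (1 + t) ^ 2 := by
    field_simp
    ring
  have h5 : (1 - t * ((1 - t) / (1 + t)) * ((1 - t) / (1 + t) / t)) ≠ 0 := by
    rw [h5']; positivity
  rw [div_eq_iff (pow_ne_zero 2 h5)]
  field_simp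
  ring

/-- The real Szegő sum of `V_β`: for `β > β_c(2)`,
`∑_{ℓ ≥ 1} ℓ V_ℓ V_{−ℓ} = −∑ (γ₁^ℓ − γ₂^ℓ)²/(4ℓ) = ¼ log [(1−γ₁²)(1−γ₂²)/(1−γ₁γ₂)²]`
(Deift–Its–Krasovsky 2013, §4, the display after eq. (51)), written with the explicit coefficients. [cite: DeiftItsKrasovsky2013, §4, after eq. (51)] -/
theorem hasSum_szego_onsager_real (hβ : criticalBetaTwo < β) :
    HasSum (fun k : ℕ => ((k : ℝ) + 1) *
        (-((onsagerGammaOne β ^ (k + 1) - onsagerGammaTwo β ^ (k + 1)) / (2 * ((k : ℝ) + 1)))) *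
        ((onsagerGammaOne β ^ (k + 1) - onsagerGammaTwo β ^ (k + 1)) / (2 * ((k : ℝ) + 1))))
      ((1 / 4 : ℝ) * Real.log ((1 - onsagerGammaOne β ^ 2) * (1 - onsagerGammaTwo β ^ 2) /
        (1 - onsagerGammaOne β * onsagerGammaTwo β) ^ 2)) := by
  have hβ0 : 0 < β := criticalBetaTwo_pos.trans hβ
  set g₁ := onsagerGammaOne β with hg₁
  set g₂ := onsagerGammaTwo β with hg₂
  have hg₁0 : 0 < g₁ := onsagerGammaOne_pos hβ0
  have hg₁1 : g₁ < 1 := onsagerGammaOne_lt_one hβ0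
  have hg₂0 : 0 < g₂ := onsagerGammaTwo_pos hβ0
  have hg₂1 : g₂ < 1 := (onsagerGammaTwo_lt_one_iff hβ0).2 hβ
  have hp1 : |g₁ ^ 2| < 1 := by
    rw [abs_of_nonneg (by positivity)]; nlinarith
  have hp2 : |g₂ ^ 2| < 1 := by
    rw [abs_of_nonneg (by positivity)]; nlinarith
  have hp3 : |g₁ * g₂| < 1 := by
    rw [abs_of_nonneg (by positivity)]; nlinarith
  have H1 := Real.hasSum_pow_div_log_of_abs_lt_one hp1
  have H2 := Real.hasSum_pow_div_log_of_abs_lt_one hp2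
  have H3 := Real.hasSum_pow_div_log_of_abs_lt_one hp3
  have H := ((H1.add H2).sub (H3.mul_left 2)).mul_left (-(1 / 4 : ℝ))
  have hlog : -(1 / 4 : ℝ) * (-Real.log (1 - g₁ ^ 2) + -Real.log (1 - g₂ ^ 2) - 2 * -Real.log (1 - g₁ * g₂)) =
      (1 / 4 : ℝ) * Real.log ((1 - g₁ ^ 2) * (1 - g₂ ^ 2) / (1 - g₁ * g₂) ^ 2) := by
    have ha : 0 < 1 - g₁ ^ 2 := by nlinarith
    have hb : 0 < 1 - g₂ ^ 2 := by nlinarith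
    have hc : 0 < 1 - g₁ * g₂ := by nlinarith
    rw [Real.log_div (mul_pos ha hb).ne' (pow_pos hc 2).ne', Real.log_mul ha.ne' hb.ne',
      Real.log_pow]
    push_cast
    ring
  rw [hlog] at H
  refine H.congr_fun ?_
  intro k
  have hk : ((k : ℝ) + 1) ≠ 0 := by positivity
  field_simp
  ring

/-- **The value of the Szegő limit** (Deift–Its–Krasovsky 2013, §4: "after some elementary algebra
using (22), we again obtain (15)", i.e. `exp(∑ ℓ V_ℓ V_{−ℓ}) = (1 − k²)^{1/4} = M_0²`): for
`β > β_c(2)`, `exp(¼ log[(1−γ₁²)(1−γ₂²)/(1−γ₁γ₂)²]) = m_O(β)²` (`onsagerYangMagnetization_sq`). [cite: DeiftItsKrasovsky2013, §4, after eq. (51), with eq. (15)] -/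
theorem exp_szego_onsager_eq_sq (hβ : criticalBetaTwo < β) :
    Real.exp ((1 / 4 : ℝ) * Real.log ((1 - onsagerGammaOne β ^ 2) * (1 - onsagerGammaTwo β ^ 2) /
        (1 - onsagerGammaOne β * onsagerGammaTwo β) ^ 2)) =
      onsagerYangMagnetization β ^ 2 := by
  rw [onsagerGamma_szego_identity (criticalBetaTwo_pos.trans hβ), onsagerYangMagnetization_sq hβ,
    Real.rpow_def_of_pos (onsagerYang_base_pos hβ), mul_comm]

/-- Geometric domination of the coefficients: for `β > β_c(2)` and `ℓ ≥ 1`,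
`|γ₁^ℓ − γ₂^ℓ|/(2ℓ) ≤ γ₂^ℓ` (`0 < γ₁ < γ₂ < 1`). [folklore] -/
theorem onsager_coeff_abs_le (hβ : criticalBetaTwo < β) {ℓ : ℕ} (hℓ : 1 ≤ ℓ) :
    |(onsagerGammaOne β ^ ℓ - onsagerGammaTwo β ^ ℓ) / (2 * ℓ)| ≤ onsagerGammaTwo β ^ ℓ := by
  have hβ0 : 0 < β := criticalBetaTwo_pos.trans hβ
  have hg₁0 : 0 ≤ onsagerGammaOne β := (onsagerGammaOne_pos hβ0).le
  have hg₂0 : 0 ≤ onsagerGammaTwo β := (onsagerGammaTwo_pos hβ0).le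
  have h12 : onsagerGammaOne β ^ ℓ ≤ onsagerGammaTwo β ^ ℓ :=
    pow_le_pow_left₀ hg₁0 (onsagerGammaOne_lt_onsagerGammaTwo hβ0).le ℓ
  have hℓ' : (1 : ℝ) ≤ ℓ := by exact_mod_cast hℓ
  rw [abs_div, abs_of_pos (by positivity : (0 : ℝ) < 2 * ℓ), abs_sub_comm,
    abs_of_nonneg (sub_nonneg.2 h12), div_le_iff₀ (by positivity : (0 : ℝ) < 2 * ℓ)]
  have hp : 0 ≤ onsagerGammaOne β ^ ℓ := pow_nonneg hg₁0 ℓ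
  have hq : 0 ≤ onsagerGammaTwo β ^ ℓ := pow_nonneg hg₂0 ℓ
  nlinarith

/-- The Fourier coefficients of `V_β` are dominated by the geometric sequence `γ₂^{|k|}`
(granting the coefficient formulas, DIK eq. (51)). [cite: DeiftItsKrasovsky2013, §4, eq. (51)] -/
theorem norm_circleCoeff_onsagerLog_le (hcoeff : onsagerLog_circleCoeff) (hβ : criticalBetaTwo < β)
    (k : ℤ) : ‖circleCoeff (onsagerLog β) k‖ ≤ onsagerGammaTwo β ^ k.natAbs := by
  obtain ⟨h0, hℓ⟩ := hcoeff hβ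
  obtain ⟨n, rfl | rfl⟩ := Int.eq_nat_or_neg k
  · rcases Nat.eq_zero_or_pos n with rfl | hpos
    · simp [h0]
    · rw [(hℓ n hpos).1, Complex.norm_real, Real.norm_eq_abs, abs_neg, Int.natAbs_natCast]
      exact onsager_coeff_abs_le hβ hpos
  · rcases Nat.eq_zero_or_pos n with rfl | hpos
    · simp [h0]
    · rw [(hℓ n hpos).2, Complex.norm_real, Real.norm_eq_abs, Int.natAbs_neg, Int.natAbs_natCast]
      exact onsager_coeff_abs_le hβ hpos

/-- The Szegő condition `∑ |k| |V_k|² < ∞` for `V_β` (geometric domination: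
`|k| |V_k|² ≤ |k| γ₂^{2|k|}`). [folklore] -/
theorem summable_abs_mul_norm_sq_circleCoeff_onsagerLog (hcoeff : onsagerLog_circleCoeff)
    (hβ : criticalBetaTwo < β) :
    Summable fun k : ℤ => (|k| : ℝ) * ‖circleCoeff (onsagerLog β) k‖ ^ 2 := by
  have hβ0 : 0 < β := criticalBetaTwo_pos.trans hβ
  have hg : 0 ≤ onsagerGammaTwo β := (onsagerGammaTwo_pos hβ0).le
  have hg1 : onsagerGammaTwo β < 1 := (onsagerGammaTwo_lt_one_iff hβ0).2 hβ
  have hr : ‖onsagerGammaTwo β ^ 2‖ < 1 := by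
    rw [Real.norm_of_nonneg (by positivity)]; nlinarith
  have hmaj : Summable fun n : ℕ => (n : ℝ) ^ 1 * (onsagerGammaTwo β ^ 2) ^ n :=
    summable_pow_mul_geometric_of_norm_lt_one 1 hr
  have hbound : ∀ k : ℤ, (|k| : ℝ) * ‖circleCoeff (onsagerLog β) k‖ ^ 2 ≤
      (k.natAbs : ℝ) ^ 1 * (onsagerGammaTwo β ^ 2) ^ k.natAbs := by
    intro k
    have h1 := norm_circleCoeff_onsagerLog_le hcoeff hβ k
    have habs : (|k| : ℝ) = (k.natAbs : ℝ) := by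
      rw [← Int.cast_abs, Int.abs_eq_natAbs]; simp
    rw [habs, pow_one, ← pow_mul, mul_comm 2, pow_mul]
    exact mul_le_mul_of_nonneg_left (pow_le_pow_left₀ (norm_nonneg _) h1 2) (Nat.cast_nonneg _)
  refine summable_int_iff_summable_nat_and_neg.2 ⟨?_, ?_⟩
  · refine Summable.of_nonneg_of_le (fun n => by positivity) (fun n => ?_) hmaj
    simpa using hbound (n : ℤ)
  · refine Summable.of_nonneg_of_le (fun n => by positivity) (fun n => ?_) hmaj
    simpa using hbound (-(n : ℤ))

/-- The complex Szegő sum `∑_{k ≥ 0} (k+1) V_{k+1} V_{−(k+1)}` of `V_β` (the exponent in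
`strongSzego`), granting the coefficient formulas: it is the real number
`¼ log[(1−γ₁²)(1−γ₂²)/(1−γ₁γ₂)²]`. [cite: DeiftItsKrasovsky2013, §4, after eq. (51)] -/
theorem hasSum_szego_onsagerLog (hcoeff : onsagerLog_circleCoeff) (hβ : criticalBetaTwo < β) :
    HasSum (fun k : ℕ => ((k : ℂ) + 1) * circleCoeff (onsagerLog β) ((k : ℤ) + 1) *
        circleCoeff (onsagerLog β) (-((k : ℤ) + 1)))
      (((1 / 4 : ℝ) * Real.log ((1 - onsagerGammaOne β ^ 2) * (1 - onsagerGammaTwo β ^ 2) /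
        (1 - onsagerGammaOne β * onsagerGammaTwo β) ^ 2) : ℝ) : ℂ) := by
  have H := Complex.hasSum_ofReal.2 (hasSum_szego_onsager_real hβ)
  refine H.congr_fun fun k => ?_
  obtain ⟨-, hℓ⟩ := hcoeff hβ
  obtain ⟨h1, h2⟩ := hℓ (k + 1) (Nat.succ_pos k)
  have e1 : ((k : ℤ) + 1) = ((k + 1 : ℕ) : ℤ) := by push_cast; ring
  rw [e1, h1, h2]
  push_cast
  ring

/-- **Montroll–Potts–Ward via Szegő** (Deift–Its–Krasovsky 2013, §4: SSLT applied to
`φ_Onsager` for `T < T_c` gives `lim D_n(φ_Onsager) = M_0² = (1 − k²)^{1/4}`, "via (16)"). Granting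
the strong Szegő limit theorem (`Literature.Analysis.Toeplitz.strongSzego`) and the coefficient
formulas (`onsagerLog_circleCoeff`): for `β > β_c(2)`, `D_n(φ_β) → m_O(β)²` as `n → ∞`. [cite: DeiftItsKrasovsky2013, §4, eqs. (50)–(51) and the following display] -/
theorem tendsto_toeplitzDet_onsagerSymbol (hSz : strongSzego) (hcoeff : onsagerLog_circleCoeff)
    (hβ : criticalBetaTwo < β) :
    Tendsto (fun n : ℕ => toeplitzDet (circleCoeff (onsagerSymbol β)) n) atTop
      (𝓝 ((onsagerYangMagnetization β ^ 2 : ℝ) : ℂ)) := by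
  have h := hSz (onsagerLog β) (continuous_onsagerLog hβ) (onsagerLog_periodic β)
    (summable_abs_mul_norm_sq_circleCoeff_onsagerLog hcoeff hβ)
  have hexp : (fun θ => Complex.exp (onsagerLog β θ)) = onsagerSymbol β := funext (exp_onsagerLog hβ)
  have h0 : circleCoeff (onsagerLog β) 0 = 0 := (hcoeff hβ).1
  rw [hexp, (hasSum_szego_onsagerLog hcoeff hβ).tsum_eq, ← Complex.ofReal_exp,
    exp_szego_onsager_eq_sq hβ] at h
  simp only [h0, mul_zero, Complex.exp_zero, div_one] at h
  exact h

end SzegoData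


/-! ### Discharge of `onsagerLog_circleCoeff`: the Fourier coefficients of `log φ_β` (DIK eq. (51)) -/

section Coefficients

open Literature.Analysis.Toeplitz MeasureTheory intervalIntegral

variable {β : ℝ}

/-- `conj (1 − γ e^{iθ}) = 1 − γ e^{−iθ}` for real `γ, θ`. [folklore] -/
theorem conj_one_sub_real_mul_exp (γ θ : ℝ) :
    (starRingEnd ℂ) (1 - (γ : ℂ) * Complex.exp (θ * I)) = 1 - (γ : ℂ) * Complex.exp (-(θ * I)) := by
  rw [map_sub, map_one, map_mul, Complex.conj_ofReal, ← Complex.exp_conj, map_mul,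
    Complex.conj_ofReal, Complex.conj_I, mul_neg]

/-- `conj (1 − γ e^{−iθ}) = 1 − γ e^{iθ}` for real `γ, θ`. [folklore] -/
theorem conj_one_sub_real_mul_exp_neg (γ θ : ℝ) :
    (starRingEnd ℂ) (1 - (γ : ℂ) * Complex.exp (-(θ * I))) = 1 - (γ : ℂ) * Complex.exp (θ * I) := by
  have h := congrArg (starRingEnd ℂ) (conj_one_sub_real_mul_exp γ θ)
  rw [Complex.conj_conj] at h
  exact h.symm

/-- `2i arg z = Log z − Log z̄` in the open right half plane (principal branch). [folklore] -/
theorem two_mul_arg_mul_I_eq_log_sub_log_conj {z : ℂ} (hz : 0 < z.re) :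
    ((2 * z.arg : ℝ) : ℂ) * I = Complex.log z - Complex.log ((starRingEnd ℂ) z) := by
  have harg : z.arg ≠ Real.pi := by
    intro h
    rw [Complex.arg_eq_pi_iff] at h
    linarith [h.1]
  rw [Complex.log_conj z harg, Complex.sub_conj, Complex.log_im]

/-- The coefficient sequence `c_n = (γ₂ⁿ − γ₁ⁿ)/(2n)` of the sine series of `V_β` (`c_0 = 0`). [cite: DeiftItsKrasovsky2013, §4, eq. (51)] -/
def onsagerCoeff (β : ℝ) (n : ℕ) : ℝ := (onsagerGammaTwo β ^ n - onsagerGammaOne β ^ n) / (2 * n)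

/-- `c_0 = 0`. [folklore] -/
theorem onsagerCoeff_zero (β : ℝ) : onsagerCoeff β 0 = 0 := by simp [onsagerCoeff]

/-- `|c_n| ≤ γ₂ⁿ` for `β > β_c(2)`. [folklore] -/
theorem abs_onsagerCoeff_le (hβ : criticalBetaTwo < β) (n : ℕ) :
    |onsagerCoeff β n| ≤ onsagerGammaTwo β ^ n := by
  rcases Nat.eq_zero_or_pos n with rfl | hn
  · simp [onsagerCoeff]
  · have h := onsager_coeff_abs_le hβ hn
    rw [onsagerCoeff, ← abs_neg, ← neg_div, neg_sub]
    exact h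

/-- **The logarithmic series of `V_β`** (Montroll–Potts–Ward 1963; DIK §4, proof of eq. (51):
`log(1 − γe^{±iθ}) = −∑_{n≥1} γⁿe^{±inθ}/n`): for `β > β_c(2)` and every `θ`,
`V_β(θ) = ∑_{n ≥ 1} c_n (e^{inθ} − e^{−inθ})`, `c_n = (γ₂ⁿ − γ₁ⁿ)/(2n)`. [cite: DeiftItsKrasovsky2013, §4, eq. (51)] -/
theorem hasSum_onsagerLog (hβ : criticalBetaTwo < β) (θ : ℝ) :
    HasSum (fun n : ℕ => (onsagerCoeff β n : ℂ) *
        (Complex.exp ((n : ℂ) * (θ * I)) - Complex.exp (-((n : ℂ) * (θ * I))))) (onsagerLog β θ) := by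
  have hβ0 : 0 < β := criticalBetaTwo_pos.trans hβ
  set g₁ := onsagerGammaOne β with hg₁
  set g₂ := onsagerGammaTwo β with hg₂
  set E : ℂ := Complex.exp (θ * I) with hE
  set E' : ℂ := Complex.exp (-(θ * I)) with hE'
  have hEn : ‖E‖ = 1 := Complex.norm_exp_ofReal_mul_I θ
  have hE'n : ‖E'‖ = 1 := by
    rw [hE', show -((θ : ℂ) * I) = ((-θ : ℝ) : ℂ) * I by push_cast; ring]
    exact Complex.norm_exp_ofReal_mul_I _
  have hg₁0 : 0 ≤ g₁ := (onsagerGammaOne_pos hβ0).le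
  have hg₂0 : 0 ≤ g₂ := (onsagerGammaTwo_pos hβ0).le
  have hg₁1 : g₁ < 1 := onsagerGammaOne_lt_one hβ0
  have hg₂1 : g₂ < 1 := (onsagerGammaTwo_lt_one_iff hβ0).2 hβ
  -- the four logarithmic series
  have hw : ∀ (g : ℝ) (F : ℂ), 0 ≤ g → g < 1 → ‖F‖ = 1 →
      HasSum (fun n : ℕ => -(((g : ℂ) * F) ^ n / n)) (Complex.log (1 - (g : ℂ) * F)) := by
    intro g F hg0 hg1 hF
    have hnorm : ‖(g : ℂ) * F‖ < 1 := by
      rw [norm_mul, Complex.norm_real, Real.norm_of_nonneg hg0, hF, mul_one]; exact hg1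
    have h := (Complex.hasSum_taylorSeries_neg_log hnorm).neg
    rw [neg_neg] at h
    exact h
  have H1 := hw g₁ E hg₁0 hg₁1 hEn      -- Log a
  have H2 := hw g₁ E' hg₁0 hg₁1 hE'n    -- Log ā
  have H3 := hw g₂ E' hg₂0 hg₂1 hE'n    -- Log b
  have H4 := hw g₂ E hg₂0 hg₂1 hEn      -- Log b̄
  have H := ((H1.sub H2).add (H3.sub H4)).mul_left (1 / 2 : ℂ)
  -- identify the sum with `V_β`
  have hV : onsagerLog β θ = (1 / 2 : ℂ) * ((Complex.log (1 - (g₁ : ℂ) * E) -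
      Complex.log (1 - (g₁ : ℂ) * E')) + (Complex.log (1 - (g₂ : ℂ) * E') -
      Complex.log (1 - (g₂ : ℂ) * E))) := by
    have ha := two_mul_arg_mul_I_eq_log_sub_log_conj (re_one_sub_gammaOne_pos hβ0 θ)
    have hb := two_mul_arg_mul_I_eq_log_sub_log_conj (re_one_sub_gammaTwo_pos hβ θ)
    rw [conj_one_sub_real_mul_exp] at ha
    rw [conj_one_sub_real_mul_exp_neg] at hb
    rw [← hg₁, ← hE, ← hE'] at ha
    rw [← hg₂, ← hE, ← hE'] at hb
    rw [← ha, ← hb, onsagerLog, ← hg₁, ← hg₂, ← hE, ← hE']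
    push_cast
    rw [Complex.log_im, Complex.log_im]
    ring
  rw [hV]
  refine H.congr_fun fun n => ?_
  -- termwise algebra: `(gF)ⁿ = gⁿ Fⁿ`, `Eⁿ = e^{inθ}`, `E'ⁿ = e^{-inθ}`
  have hEpow : E ^ n = Complex.exp ((n : ℂ) * (θ * I)) := by rw [hE, ← Complex.exp_nat_mul]
  have hE'pow : E' ^ n = Complex.exp (-((n : ℂ) * (θ * I))) := by
    rw [hE', ← Complex.exp_nat_mul, mul_neg]
  rcases Nat.eq_zero_or_pos n with rfl | hn
  · simp [onsagerCoeff]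
  · have hn' : (n : ℂ) ≠ 0 := by exact_mod_cast hn.ne'
    rw [onsagerCoeff, ← hg₁, ← hg₂, mul_pow, mul_pow, mul_pow, mul_pow, hEpow, hE'pow]
    push_cast
    field_simp
    ring

/-- `∫_{-π}^{π} e^{imθ} dθ = 2π` if `m = 0` and `0` otherwise (`m ∈ ℤ`). [folklore] -/
theorem integral_exp_int_mul_I (m : ℤ) :
    (∫ θ in (-Real.pi)..Real.pi, Complex.exp ((m : ℂ) * θ * I)) =
      if m = 0 then 2 * (Real.pi : ℂ) else 0 := by
  split_ifs with hm
  · subst hm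
    simp [two_mul]
  · have hc : (m : ℂ) * I ≠ 0 := mul_ne_zero (by exact_mod_cast hm) Complex.I_ne_zero
    have h := integral_exp_mul_complex (a := -Real.pi) (b := Real.pi) hc
    have hfun : (fun θ : ℝ => Complex.exp ((m : ℂ) * θ * I)) =
        fun θ : ℝ => Complex.exp ((m : ℂ) * I * θ) := by
      funext θ; ring_nf
    rw [hfun, h]
    -- `e^{imπ} = e^{-imπ}` since `e^{2πim} = 1`
    have hper : Complex.exp ((m : ℂ) * I * Real.pi) = Complex.exp ((m : ℂ) * I * ↑(-Real.pi)) := by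
      have h1 := Complex.exp_int_mul_two_pi_mul_I m
      rw [show (m : ℂ) * I * Real.pi = (m : ℂ) * I * ↑(-Real.pi) + m * (2 * Real.pi * I) by
        push_cast; ring, Complex.exp_add, h1, mul_one]
    rw [hper, sub_self, zero_div]

/-- The integrals of the terms against `e^{-iℓθ}`, `ℓ ≥ 1`: only `n = ℓ` survives, with value
`2π c_ℓ`. [folklore] -/
theorem integral_term_pos (β : ℝ) {ℓ : ℕ} (hℓ : 1 ≤ ℓ) (n : ℕ) :
    (∫ θ in (-Real.pi)..Real.pi, Complex.exp (-((ℓ : ℤ) * θ * I)) *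
        ((onsagerCoeff β n : ℂ) * (Complex.exp ((n : ℂ) * (θ * I)) - Complex.exp (-((n : ℂ) * (θ * I)))))) =
      if n = ℓ then 2 * (Real.pi : ℂ) * (onsagerCoeff β ℓ : ℂ) else 0 := by
  have hsplit : (fun θ : ℝ => Complex.exp (-((ℓ : ℤ) * θ * I)) *
      ((onsagerCoeff β n : ℂ) * (Complex.exp ((n : ℂ) * (θ * I)) - Complex.exp (-((n : ℂ) * (θ * I)))))) =
      fun θ : ℝ => (onsagerCoeff β n : ℂ) * Complex.exp ((((n : ℤ) - ℓ : ℤ) : ℂ) * θ * I) -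
        (onsagerCoeff β n : ℂ) * Complex.exp (((-((n : ℤ) + ℓ) : ℤ) : ℂ) * θ * I) := by
    funext θ
    have e1 : Complex.exp (-((ℓ : ℤ) * θ * I)) * Complex.exp ((n : ℂ) * (θ * I)) =
        Complex.exp ((((n : ℤ) - ℓ : ℤ) : ℂ) * θ * I) := by
      rw [← Complex.exp_add]; congr 1; push_cast; ring
    have e2 : Complex.exp (-((ℓ : ℤ) * θ * I)) * Complex.exp (-((n : ℂ) * (θ * I))) =
        Complex.exp (((-((n : ℤ) + ℓ) : ℤ) : ℂ) * θ * I) := by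
      rw [← Complex.exp_add]; congr 1; push_cast; ring
    rw [← e1, ← e2]; ring
  have hint1 : IntervalIntegrable (fun θ : ℝ => (onsagerCoeff β n : ℂ) *
      Complex.exp ((((n : ℤ) - ℓ : ℤ) : ℂ) * θ * I)) MeasureTheory.volume (-Real.pi) Real.pi :=
    (Continuous.intervalIntegrable (by fun_prop) _ _)
  have hint2 : IntervalIntegrable (fun θ : ℝ => (onsagerCoeff β n : ℂ) *
      Complex.exp (((-((n : ℤ) + ℓ) : ℤ) : ℂ) * θ * I)) MeasureTheory.volume (-Real.pi) Real.pi :=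
    (Continuous.intervalIntegrable (by fun_prop) _ _)
  rw [hsplit, intervalIntegral.integral_sub hint1 hint2, intervalIntegral.integral_const_mul,
    intervalIntegral.integral_const_mul, integral_exp_int_mul_I, integral_exp_int_mul_I]
  have hne : (-((n : ℤ) + ℓ) : ℤ) ≠ 0 := by omega
  rw [if_neg hne, mul_zero, sub_zero]
  by_cases hnl : n = ℓ
  · subst hnl; simp [mul_comm]
  · have : ((n : ℤ) - ℓ : ℤ) ≠ 0 := by omega
    rw [if_neg this, if_neg hnl, mul_zero]

/-- The integrals of the terms against `e^{+iℓθ}`, `ℓ ≥ 1`: only `n = ℓ` survives, with value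
`−2π c_ℓ`. [folklore] -/
theorem integral_term_neg (β : ℝ) {ℓ : ℕ} (hℓ : 1 ≤ ℓ) (n : ℕ) :
    (∫ θ in (-Real.pi)..Real.pi, Complex.exp (-((-(ℓ : ℤ) : ℤ) * θ * I)) *
        ((onsagerCoeff β n : ℂ) * (Complex.exp ((n : ℂ) * (θ * I)) - Complex.exp (-((n : ℂ) * (θ * I)))))) =
      if n = ℓ then -(2 * (Real.pi : ℂ) * (onsagerCoeff β ℓ : ℂ)) else 0 := by
  have hsplit : (fun θ : ℝ => Complex.exp (-((-(ℓ : ℤ) : ℤ) * θ * I)) *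
      ((onsagerCoeff β n : ℂ) * (Complex.exp ((n : ℂ) * (θ * I)) - Complex.exp (-((n : ℂ) * (θ * I)))))) =
      fun θ : ℝ => (onsagerCoeff β n : ℂ) * Complex.exp ((((n : ℤ) + ℓ : ℤ) : ℂ) * θ * I) -
        (onsagerCoeff β n : ℂ) * Complex.exp ((((ℓ : ℤ) - n : ℤ) : ℂ) * θ * I) := by
    funext θ
    have e1 : Complex.exp (-((-(ℓ : ℤ) : ℤ) * θ * I)) * Complex.exp ((n : ℂ) * (θ * I)) =
        Complex.exp ((((n : ℤ) + ℓ : ℤ) : ℂ) * θ * I) := by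
      rw [← Complex.exp_add]; congr 1; push_cast; ring
    have e2 : Complex.exp (-((-(ℓ : ℤ) : ℤ) * θ * I)) * Complex.exp (-((n : ℂ) * (θ * I))) =
        Complex.exp ((((ℓ : ℤ) - n : ℤ) : ℂ) * θ * I) := by
      rw [← Complex.exp_add]; congr 1; push_cast; ring
    rw [← e1, ← e2]; ring
  have hint1 : IntervalIntegrable (fun θ : ℝ => (onsagerCoeff β n : ℂ) *
      Complex.exp ((((n : ℤ) + ℓ : ℤ) : ℂ) * θ * I)) MeasureTheory.volume (-Real.pi) Real.pi :=
    (Continuous.intervalIntegrable (by fun_prop) _ _)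
  have hint2 : IntervalIntegrable (fun θ : ℝ => (onsagerCoeff β n : ℂ) *
      Complex.exp ((((ℓ : ℤ) - n : ℤ) : ℂ) * θ * I)) MeasureTheory.volume (-Real.pi) Real.pi :=
    (Continuous.intervalIntegrable (by fun_prop) _ _)
  rw [hsplit, intervalIntegral.integral_sub hint1 hint2, intervalIntegral.integral_const_mul,
    intervalIntegral.integral_const_mul, integral_exp_int_mul_I, integral_exp_int_mul_I]
  have hne : ((n : ℤ) + ℓ : ℤ) ≠ 0 := by omega
  rw [if_neg hne, mul_zero, zero_sub]
  by_cases hnl : n = ℓ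
  · subst hnl; simp [mul_comm]
  · have : ((ℓ : ℤ) - n : ℤ) ≠ 0 := by omega
    rw [if_neg this, if_neg hnl, mul_zero, neg_zero]

/-- The integrals of the terms against `1` vanish (`ℓ = 0`). [folklore] -/
theorem integral_term_zero (β : ℝ) (n : ℕ) :
    (∫ θ in (-Real.pi)..Real.pi, Complex.exp (-((0 : ℤ) * θ * I)) *
        ((onsagerCoeff β n : ℂ) * (Complex.exp ((n : ℂ) * (θ * I)) - Complex.exp (-((n : ℂ) * (θ * I)))))) =
      0 := by
  have hsplit : (fun θ : ℝ => Complex.exp (-((0 : ℤ) * θ * I)) *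
      ((onsagerCoeff β n : ℂ) * (Complex.exp ((n : ℂ) * (θ * I)) - Complex.exp (-((n : ℂ) * (θ * I)))))) =
      fun θ : ℝ => (onsagerCoeff β n : ℂ) * Complex.exp ((((n : ℤ) : ℤ) : ℂ) * θ * I) -
        (onsagerCoeff β n : ℂ) * Complex.exp (((-(n : ℤ) : ℤ) : ℂ) * θ * I) := by
    funext θ
    have e1 : Complex.exp (-((0 : ℤ) * θ * I)) * Complex.exp ((n : ℂ) * (θ * I)) =
        Complex.exp ((((n : ℤ) : ℤ) : ℂ) * θ * I) := by
      rw [← Complex.exp_add]; congr 1; push_cast; ring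
    have e2 : Complex.exp (-((0 : ℤ) * θ * I)) * Complex.exp (-((n : ℂ) * (θ * I))) =
        Complex.exp (((-(n : ℤ) : ℤ) : ℂ) * θ * I) := by
      rw [← Complex.exp_add]; congr 1; push_cast; ring
    rw [← e1, ← e2]; ring
  have hint1 : IntervalIntegrable (fun θ : ℝ => (onsagerCoeff β n : ℂ) *
      Complex.exp ((((n : ℤ) : ℤ) : ℂ) * θ * I)) MeasureTheory.volume (-Real.pi) Real.pi :=
    (Continuous.intervalIntegrable (by fun_prop) _ _)
  have hint2 : IntervalIntegrable (fun θ : ℝ => (onsagerCoeff β n : ℂ) *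
      Complex.exp (((-(n : ℤ) : ℤ) : ℂ) * θ * I)) MeasureTheory.volume (-Real.pi) Real.pi :=
    (Continuous.intervalIntegrable (by fun_prop) _ _)
  rw [hsplit, intervalIntegral.integral_sub hint1 hint2, intervalIntegral.integral_const_mul,
    intervalIntegral.integral_const_mul, integral_exp_int_mul_I, integral_exp_int_mul_I]
  by_cases hn : n = 0
  · subst hn; simp
  · have h1 : ((n : ℤ) : ℤ) ≠ 0 := by exact_mod_cast hn
    have h2 : (-(n : ℤ) : ℤ) ≠ 0 := by omega
    rw [if_neg h1, if_neg h2, mul_zero, sub_zero]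

/-- **Termwise integration** (dominated convergence, dominating sequence `2γ₂ⁿ`): for `β > β_c(2)`
and every `ℓ`, `∫_{-π}^{π} e^{-iℓθ} V_β(θ) dθ = ∑_n ∫_{-π}^{π} e^{-iℓθ} c_n (e^{inθ} − e^{-inθ}) dθ`. [folklore] -/
theorem hasSum_integral_onsagerLog (hβ : criticalBetaTwo < β) (ℓ : ℤ) :
    HasSum (fun n : ℕ => ∫ θ in (-Real.pi)..Real.pi, Complex.exp (-((ℓ : ℂ) * θ * I)) *
        ((onsagerCoeff β n : ℂ) * (Complex.exp ((n : ℂ) * (θ * I)) - Complex.exp (-((n : ℂ) * (θ * I))))))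
      (∫ θ in (-Real.pi)..Real.pi, Complex.exp (-((ℓ : ℂ) * θ * I)) * onsagerLog β θ) := by
  have hβ0 : 0 < β := criticalBetaTwo_pos.trans hβ
  have hg : 0 ≤ onsagerGammaTwo β := (onsagerGammaTwo_pos hβ0).le
  have hg1 : onsagerGammaTwo β < 1 := (onsagerGammaTwo_lt_one_iff hβ0).2 hβ
  refine intervalIntegral.hasSum_integral_of_dominated_convergence
    (fun n _ => 2 * onsagerGammaTwo β ^ n) (fun n => ?_) (fun n => ?_) ?_ ?_ ?_
  · exact Continuous.aestronglyMeasurable (by fun_prop)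
  · refine Filter.Eventually.of_forall fun θ _ => ?_
    have h1 : ‖Complex.exp (-((ℓ : ℂ) * θ * I))‖ = 1 := by
      rw [show -((ℓ : ℂ) * θ * I) = ((-(ℓ * θ) : ℝ) : ℂ) * I by push_cast; ring]
      exact Complex.norm_exp_ofReal_mul_I _
    have h2 : ‖Complex.exp ((n : ℂ) * (θ * I)) - Complex.exp (-((n : ℂ) * (θ * I)))‖ ≤ 2 := by
      refine (norm_sub_le _ _).trans ?_
      rw [show (n : ℂ) * (θ * I) = ((n * θ : ℝ) : ℂ) * I by push_cast; ring,
        show -(((n * θ : ℝ) : ℂ) * I) = ((-(n * θ) : ℝ) : ℂ) * I by push_cast; ring,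
        Complex.norm_exp_ofReal_mul_I, Complex.norm_exp_ofReal_mul_I]
      norm_num
    have h3 : ‖(onsagerCoeff β n : ℂ)‖ ≤ onsagerGammaTwo β ^ n := by
      rw [Complex.norm_real, Real.norm_eq_abs]; exact abs_onsagerCoeff_le hβ n
    calc ‖Complex.exp (-((ℓ : ℂ) * θ * I)) * ((onsagerCoeff β n : ℂ) *
          (Complex.exp ((n : ℂ) * (θ * I)) - Complex.exp (-((n : ℂ) * (θ * I)))))‖
        = ‖(onsagerCoeff β n : ℂ)‖ *
          ‖Complex.exp ((n : ℂ) * (θ * I)) - Complex.exp (-((n : ℂ) * (θ * I)))‖ := by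
          rw [norm_mul, norm_mul, h1, one_mul]
      _ ≤ onsagerGammaTwo β ^ n * 2 :=
          mul_le_mul h3 h2 (norm_nonneg _) (pow_nonneg hg n)
      _ = 2 * onsagerGammaTwo β ^ n := mul_comm _ _
  · exact Filter.Eventually.of_forall fun θ _ =>
      (summable_geometric_of_lt_one hg hg1).mul_left 2
  · exact intervalIntegrable_const
  · exact Filter.Eventually.of_forall fun θ _ => (hasSum_onsagerLog hβ θ).mul_left _

/-- **DIK eq. (51), proved**: the Fourier coefficients of `V_β = log φ_β` for `β > β_c(2)` are
`V_0 = 0`, `V_ℓ = −(γ₁^ℓ − γ₂^ℓ)/(2ℓ)`, `V_{−ℓ} = (γ₁^ℓ − γ₂^ℓ)/(2ℓ)` (`ℓ ≥ 1`) — the discharge of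
the named fact `onsagerLog_circleCoeff`. [cite: DeiftItsKrasovsky2013, §4, eq. (51)] -/
theorem onsagerLog_circleCoeff_holds : onsagerLog_circleCoeff := by
  intro β hβ
  have h2π : (2 * Real.pi : ℂ) ≠ 0 := by
    exact_mod_cast (mul_pos two_pos Real.pi_pos).ne'
  refine ⟨?_, fun ℓ hℓ => ⟨?_, ?_⟩⟩
  · -- `ℓ = 0`
    have hs := hasSum_integral_onsagerLog hβ 0
    have hz : HasSum (fun n : ℕ => ∫ θ in (-Real.pi)..Real.pi, Complex.exp (-(((0 : ℤ) : ℂ) * θ * I)) *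
        ((onsagerCoeff β n : ℂ) * (Complex.exp ((n : ℂ) * (θ * I)) -
          Complex.exp (-((n : ℂ) * (θ * I)))))) 0 := by
      have : (fun n : ℕ => ∫ θ in (-Real.pi)..Real.pi, Complex.exp (-(((0 : ℤ) : ℂ) * θ * I)) *
        ((onsagerCoeff β n : ℂ) * (Complex.exp ((n : ℂ) * (θ * I)) -
          Complex.exp (-((n : ℂ) * (θ * I)))))) = fun _ => 0 :=
        funext fun n => integral_term_zero β n
      rw [this]; exact hasSum_zero
    have hint : (∫ θ in (-Real.pi)..Real.pi, Complex.exp (-(((0 : ℤ) : ℂ) * θ * I)) *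
        onsagerLog β θ) = 0 := hs.unique hz
    rw [circleCoeff]
    push_cast at hint ⊢
    rw [hint, mul_zero]
  · -- `ℓ ≥ 1`
    have hs := hasSum_integral_onsagerLog hβ ℓ
    have hval : HasSum (fun n : ℕ => ∫ θ in (-Real.pi)..Real.pi, Complex.exp (-(((ℓ : ℤ) : ℂ) * θ * I)) *
        ((onsagerCoeff β n : ℂ) * (Complex.exp ((n : ℂ) * (θ * I)) -
          Complex.exp (-((n : ℂ) * (θ * I))))))
        (2 * (Real.pi : ℂ) * (onsagerCoeff β ℓ : ℂ)) := by
      have heq : (fun n : ℕ => ∫ θ in (-Real.pi)..Real.pi, Complex.exp (-(((ℓ : ℤ) : ℂ) * θ * I)) *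
          ((onsagerCoeff β n : ℂ) * (Complex.exp ((n : ℂ) * (θ * I)) -
            Complex.exp (-((n : ℂ) * (θ * I)))))) =
          fun n : ℕ => if n = ℓ then 2 * (Real.pi : ℂ) * (onsagerCoeff β ℓ : ℂ) else 0 :=
        funext fun n => integral_term_pos β hℓ n
      rw [heq]
      exact hasSum_ite_eq ℓ _
    have hint := hs.unique hval
    have hℓ0 : (ℓ : ℂ) ≠ 0 := by exact_mod_cast (by omega : ℓ ≠ 0)
    rw [circleCoeff]
    push_cast at hint ⊢
    rw [hint, onsagerCoeff]
    push_cast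
    field_simp
    ring
  · -- `-ℓ`, `ℓ ≥ 1`
    have hs := hasSum_integral_onsagerLog hβ (-(ℓ : ℤ))
    have hval : HasSum (fun n : ℕ => ∫ θ in (-Real.pi)..Real.pi,
        Complex.exp (-(((-(ℓ : ℤ) : ℤ) : ℂ) * θ * I)) *
        ((onsagerCoeff β n : ℂ) * (Complex.exp ((n : ℂ) * (θ * I)) -
          Complex.exp (-((n : ℂ) * (θ * I))))))
        (-(2 * (Real.pi : ℂ) * (onsagerCoeff β ℓ : ℂ))) := by
      have heq : (fun n : ℕ => ∫ θ in (-Real.pi)..Real.pi,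
          Complex.exp (-(((-(ℓ : ℤ) : ℤ) : ℂ) * θ * I)) *
          ((onsagerCoeff β n : ℂ) * (Complex.exp ((n : ℂ) * (θ * I)) -
            Complex.exp (-((n : ℂ) * (θ * I)))))) =
          fun n : ℕ => if n = ℓ then -(2 * (Real.pi : ℂ) * (onsagerCoeff β ℓ : ℂ)) else 0 :=
        funext fun n => integral_term_neg β hℓ n
      rw [heq]
      exact hasSum_ite_eq ℓ _
    have hint := hs.unique hval
    have hℓ0 : (ℓ : ℂ) ≠ 0 := by exact_mod_cast (by omega : ℓ ≠ 0)
    rw [circleCoeff]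
    push_cast at hint ⊢
    rw [hint, onsagerCoeff]
    push_cast
    field_simp
    ring

end Coefficients

/-! ### From the Toeplitz facts to BGJS (3.3), (3.4) and Lebowitz's (3.3) -/

section Reduction

open Literature.Analysis.Toeplitz

variable {β : ℝ}

/-- **BGJS (3.3), outer layer, from the Toeplitz identity**: for `β > 0`, `β ≠ β_c(2)`, the outer
limit `N → ∞` of the inner limits exists (real part of a convergent complex sequence). [cite: BenettinGallavottiJonaLasinioStella1973, §3 b), eq. (3.3)] -/
theorem tendsto_torusRowPair_outer_of_toeplitz (hT : torusRowPair_tendsto_toeplitzDet)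
    (hβ : 0 < β) (hβc : β ≠ criticalBetaTwo) (k : ℕ) :
    Tendsto (fun N : ℕ => limUnder atTop fun M : ℕ => torusRowPair β N M k) atTop
      (𝓝 (toeplitzDet (circleCoeff (onsagerSymbol β)) k).re) :=
  ((Complex.continuous_re.tendsto _).comp (hT hβ hβc k)).congr fun _ => rfl

/-- The periodic row limit IS the Toeplitz determinant: `(σ_{(0,0)}σ_{(k,0)})_p(β) = Re D_k(φ_β)` and
`D_k(φ_β)` is real (a limit of real numbers), for `β > 0`, `β ≠ β_c(2)`. [cite: DeiftItsKrasovsky2013, §4, eq. (50)] -/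
theorem torusRowPairLimit_eq_toeplitzDet (hT : torusRowPair_tendsto_toeplitzDet) (hβ : 0 < β)
    (hβc : β ≠ criticalBetaTwo) (k : ℕ) :
    ((torusRowPairLimit β k : ℝ) : ℂ) = toeplitzDet (circleCoeff (onsagerSymbol β)) k := by
  have hre : torusRowPairLimit β k = (toeplitzDet (circleCoeff (onsagerSymbol β)) k).re :=
    (tendsto_torusRowPair_outer_of_toeplitz hT hβ hβc k).limUnder_eq
  have him : (toeplitzDet (circleCoeff (onsagerSymbol β)) k).im = 0 := by
    have h1 := (Complex.continuous_im.tendsto _).comp (hT hβ hβc k)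
    have h2 : Tendsto (fun N : ℕ =>
        (((limUnder atTop fun M : ℕ => torusRowPair β N M k : ℝ) : ℂ)).im) atTop (𝓝 0) := by
      simp
    exact tendsto_nhds_unique h1 h2
  apply Complex.ext
  · simp [hre]
  · simp [him]

/-- **BGJS (3.7) at one temperature** (the GKS sandwich `⟨σσ⟩^∅ ≤ (σσ)_p ≤ ⟨σσ⟩⁺`, proof of
`OnsagerYang.torusRowPairLimit_sandwich_of_exists` run at a fixed `β ≥ 0` and `k`, granting only
the existence of the inner limits `M → ∞` — a theorem, `tendsto_torusRowPair_inner` — and of the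
outer limit `N → ∞` at this `β`, `k`). [cite: BenettinGallavottiJonaLasinioStella1973, eq. (3.7)] -/
theorem torusRowPairLimit_sandwich_at (hβ : 0 ≤ β) {k : ℕ} {ρ : ℝ}
    (hout : Tendsto (fun N : ℕ => limUnder atTop fun M : ℕ => torusRowPair β N M k) atTop (𝓝 ρ)) :
    twoPointFree 2 β ![(k : ℤ), 0] ≤ torusRowPairLimit β k ∧
      torusRowPairLimit β k ≤ twoPointPlus 2 β ![(k : ℤ), 0] := by
  have hlim : torusRowPairLimit β k = ρ := hout.limUnder_eq
  have hinner : ∀ N : ℕ, Tendsto (fun M : ℕ => torusRowPair β N M k) atTop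
      (𝓝 (limUnder atTop fun M : ℕ => torusRowPair β N M k)) :=
    fun N => tendsto_nhds_limUnder (tendsto_torusRowPair_inner hβ N k)
  rw [hlim]
  rcases Nat.eq_zero_or_pos k with rfl | hk
  · have h0 : (![((0 : ℕ) : ℤ), 0] : Site 2) = 0 := by
      rw [funext_iff, Fin.forall_fin_two]; simp
    rw [h0, twoPointFree_zero, twoPointPlus_zero]
    have hin1 : ∀ N : ℕ, 0 < N → (limUnder atTop fun M : ℕ => torusRowPair β N M 0) = 1 := by
      intro N hN
      refine Tendsto.limUnder_eq ?_
      refine tendsto_const_nhds.congr' ?_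
      filter_upwards [eventually_gt_atTop 0] with M hM
      exact (torusRowPair_zero hN hM).symm
    have hout1 : Tendsto (fun N : ℕ => limUnder atTop fun M : ℕ => torusRowPair β N M 0) atTop
        (𝓝 1) := by
      refine tendsto_const_nhds.congr' ?_
      filter_upwards [eventually_gt_atTop 0] with N hN
      exact (hin1 N hN).symm
    have hρ : ρ = 1 := tendsto_nhds_unique hout hout1
    rw [hρ]
    exact ⟨le_rfl, le_rfl⟩
  · have hk0 : (![(k : ℤ), 0] : Site 2) ≠ 0 := vec_ne_zero_of_ne_zero (by omega)
    constructor
    · rw [twoPointFree_eq_freeCorr β hk0]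
      refine le_of_tendsto (hasBoxLimit_isingCorr_free_holds hβ le_rfl {0, ![(k : ℤ), 0]}) ?_
      filter_upwards [eventually_ge_atTop k] with L hL
      refine ge_of_tendsto hout ?_
      filter_upwards [eventually_ge_atTop (2 * L + 3)] with N hN
      refine ge_of_tendsto (hinner N) ?_
      filter_upwards [eventually_ge_atTop (2 * L + 3)] with M hM
      exact isingCorr_free_box_le_torusRowPair hβ hN hM hk hL
    · rw [twoPointPlus_eq_plusCorr β hk0]
      refine ge_of_tendsto (hasBoxLimit_isingCorr_plus_holds hβ le_rfl {0, ![(k : ℤ), 0]}) ?_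
      filter_upwards [eventually_ge_atTop k] with L hL
      refine le_of_tendsto hout ?_
      filter_upwards [eventually_ge_atTop (2 * L + 3)] with N hN
      refine le_of_tendsto (hinner N) ?_
      filter_upwards [eventually_ge_atTop (2 * L + 3)] with M hM
      exact torusRowPair_le_isingCorr_plus_box hβ hN hM hk hL

/-- **BGJS (3.4) from the Toeplitz facts**: granting the Toeplitz identity, SSLT and the
coefficient formulas, `(σ_{(0,0)}σ_{(k,0)})_p(β) → m_O(β)²` for `β > β_c(2)` — the named fact
`torusRowPairLimit_tendsto_onsagerYang_sq` of `OnsagerYang.lean` (Montroll–Potts–Ward 1963). [cite: BenettinGallavottiJonaLasinioStella1973, §3 b), eq. (3.4)] -/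
theorem torusRowPairLimit_tendsto_onsagerYang_sq_of_toeplitz (hT : torusRowPair_tendsto_toeplitzDet)
    (hSz : strongSzego) : torusRowPairLimit_tendsto_onsagerYang_sq := by
  intro β hβ
  have hβ0 : 0 < β := criticalBetaTwo_pos.trans hβ
  have h := (Complex.continuous_re.tendsto _).comp
    (tendsto_toeplitzDet_onsagerSymbol hSz onsagerLog_circleCoeff_holds hβ)
  have heq : ∀ k : ℕ, (toeplitzDet (circleCoeff (onsagerSymbol β)) k).re = torusRowPairLimit β k :=
    fun k => by rw [← torusRowPairLimit_eq_toeplitzDet hT hβ0 hβ.ne' k, Complex.ofReal_re]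
  simp only [Function.comp_def, Complex.ofReal_re] at h
  exact h.congr heq

/-- **Lebowitz's eq. (3.3) from Wu's theorem**: granting the Toeplitz identity and the decay of
`D_k(φ_β)` above `T_c`, the periodic row two-point function decays exponentially for
`0 < β < β_c(2)` — the named fact `torusRowPairLimit_exp_decay_of_lt_criticalBetaTwo` of
`OnsagerYangProofs.lean`. [cite: Lebowitz1972, §III, eq. (3.3)] -/
theorem torusRowPairLimit_exp_decay_of_toeplitz (hT : torusRowPair_tendsto_toeplitzDet)
    (hWu : toeplitzDet_onsagerSymbol_exp_decay) :
    torusRowPairLimit_exp_decay_of_lt_criticalBetaTwo := by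
  intro β hβ0 hβ
  obtain ⟨C, c, hc, hk⟩ := hWu hβ0 hβ
  refine ⟨C, c, hc, fun k => ?_⟩
  have h1 : torusRowPairLimit β k = (toeplitzDet (circleCoeff (onsagerSymbol β)) k).re := by
    rw [← torusRowPairLimit_eq_toeplitzDet hT hβ0 hβ.ne k, Complex.ofReal_re]
  rw [h1]
  exact (Complex.re_le_norm _).trans (hk k)

end Reduction

/-! ### `onsager_yang` from the Toeplitz form of the exact solution -/

section Assembly

open Literature.Analysis.Toeplitz

/-- **The subcritical half of BGJS c) from Wu's theorem** (Lebowitz 1972, §III): granting the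
Toeplitz identity and the decay of `D_k(φ_β)` for `β < β_c(2)`, `m*(β) = 0` for `0 ≤ β < β_c(2)`
(free row function ≤ periodic limit ≤ `|D_k| ≤ C e^{-ck}`, then Messager–Miracle-Solé and the
GHS boundary-field bound, `OnsagerYangProofs`). [cite: Lebowitz1972, §III (β_O = β_c)] -/
theorem spontaneousMagnetization_two_eq_zero_of_toeplitz (hT : torusRowPair_tendsto_toeplitzDet)
    (hWu : toeplitzDet_onsagerSymbol_exp_decay) ⦃β : ℝ⦄ (hβ0 : 0 ≤ β) (hβ : β < criticalBetaTwo) :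
    spontaneousMagnetization 2 β = 0 := by
  rcases hβ0.eq_or_lt with h0 | hpos
  · rw [← h0]
    exact spontaneousMagnetization_zero 2
  · obtain ⟨C, c, hc, hk⟩ := torusRowPairLimit_exp_decay_of_toeplitz hT hWu hpos hβ
    have hrow : ∀ k : ℕ, twoPointFree 2 β ![(k : ℤ), 0] ≤ C * Real.exp (-c * k) := fun k =>
      (torusRowPairLimit_sandwich_at hβ0
        (tendsto_torusRowPair_outer_of_toeplitz hT hpos hβ.ne k)).1.trans (hk k)
    exact spontaneousMagnetization_eq_zero_of_twoPointFree_exp_decay hβ0 hc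
      (twoPointFree_exp_decay_of_row hβ0 hrow)

/-- **BGJS (3.1)+(3.4) from the Toeplitz facts**: the long-range order of the plus state along a
row, `⟨σ₀σ_{(n,0)}⟩⁺_β → m_O(β)²` for `β > β_c(2)` (the named fact
`twoPointPlus_row_tendsto_onsagerYang_sq` of `OnsagerYang.lean`): the sandwich (3.7) at `β`, the
duality identity (3.10) at `β` (from `m*(β*) = 0`, previous theorem at `β* < β_c(2)`) and (3.4). [cite: BenettinGallavottiJonaLasinioStella1973, §3, eq. (3.1) with eq. (3.4)] -/
theorem twoPointPlus_row_tendsto_onsagerYang_sq_of_toeplitz (hT : torusRowPair_tendsto_toeplitzDet)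
    (hSz : strongSzego) (hWu : toeplitzDet_onsagerSymbol_exp_decay) :
    twoPointPlus_row_tendsto_onsagerYang_sq := by
  intro β hβ
  have hβ0 : 0 < β := criticalBetaTwo_pos.trans hβ
  have hdual : ∀ x : Site 2, twoPointFree 2 β x = twoPointPlus 2 β x :=
    twoPointFree_eq_twoPointPlus_of_spontaneousMagnetization_dualBeta_eq_zero hβ0
      (spontaneousMagnetization_two_eq_zero_of_toeplitz hT hWu (dualBeta_pos hβ0).le
        (dualBeta_lt_criticalBetaTwo hβ))
  have heq : ∀ k : ℕ, torusRowPairLimit β k = twoPointPlus 2 β ![(k : ℤ), 0] := fun k => by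
    obtain ⟨h1, h2⟩ := torusRowPairLimit_sandwich_at hβ0.le
      (tendsto_torusRowPair_outer_of_toeplitz hT hβ0 hβ.ne' k)
    rw [hdual] at h1
    exact le_antisymm h2 h1
  exact (torusRowPairLimit_tendsto_onsagerYang_sq_of_toeplitz hT hSz hβ).congr heq

/-- **`onsager_yang` from the Toeplitz form of the exact solution.** The Onsager–Yang formula
(`onsager_yang` of `PlanarIsing.lean`, crit-ising.S16) follows from: (i) the Montroll–Potts–Ward /
Schultz–Mattis–Lieb identity of the row two-point function with the Toeplitz determinant of
Onsager's symbol (`torusRowPair_tendsto_toeplitzDet`, DIK eq. (50)); (ii) the strong Szegő limit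
theorem (`Literature.Analysis.Toeplitz.strongSzego`, DIK Thm. 7); (iii) Wu's decay of
`D_k(φ_Onsager)` above `T_c` (`toeplitzDet_onsagerSymbol_exp_decay`, DIK eq. (64)). Everything
else — GKS, the transfer matrix limit `M → ∞`, clustering and right-continuity of the plus state,
Kramers–Wannier duality, the Lebowitz–Martin-Löf criterion, Lebowitz's `β_O = β_c`,
Messager–Miracle-Solé, the Fourier coefficients of `log φ_Onsager` (DIK eq. (51),
`onsagerLog_circleCoeff_holds`) and the "elementary algebra"
`exp(∑ ℓV_ℓV_{−ℓ}) = (1 − sinh^{-4}2β)^{1/4}` — is proved in the tree.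
(Benettin–Gallavotti–Jona-Lasinio–Stella 1973, §3; Deift–Its–Krasovsky 2013, §4.) [cite: BenettinGallavottiJonaLasinioStella1973, §3 (main result)] -/
theorem onsager_yang_of_toeplitz (hT : torusRowPair_tendsto_toeplitzDet) (hSz : strongSzego)
    (hWu : toeplitzDet_onsagerSymbol_exp_decay) : onsager_yang :=
  have hgt : ∀ ⦃β : ℝ⦄, criticalBetaTwo < β →
      spontaneousMagnetization 2 β = onsagerYangMagnetization β :=
    fun _ hβ => spontaneousMagnetization_two_eq_onsagerYang_of_gt
      (twoPointPlus_row_tendsto_onsagerYang_sq_of_toeplitz hT hSz hWu)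
      twoPointPlus_tendsto_spontaneousMagnetization_sq_holds spontaneousMagnetization_nonneg_holds hβ
  onsager_yang_of_parts hgt (spontaneousMagnetization_two_eq_zero_of_toeplitz hT hWu)
    (spontaneousMagnetization_two_criticalBetaTwo_eq_zero_of hgt plusCorr_rightContinuous_holds)

/-- **`criticalBeta_two` (crit-ising.S15) from the Toeplitz form of the exact solution.** [cite: Lebowitz1972, §III (β_O = β_c)] -/
theorem criticalBeta_two_of_toeplitz (hT : torusRowPair_tendsto_toeplitzDet) (hSz : strongSzego)
    (hWu : toeplitzDet_onsagerSymbol_exp_decay) : criticalBeta_two :=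
  criticalBeta_two_of_onsager_yang (onsager_yang_of_toeplitz hT hSz hWu)

end Assembly

end Literature.Probability.LatticeModels
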